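/-
Copyright (c) 2026 the pub-hodgecm-mathlib formalisation cell (harness21).  Prover seat hodgecm-mathlib-K2Liu-p02 (g2),
Track B «K2-LIT» ∕ hLiu418 #184♮, unit U6 «FIRST TERM», socket #42R (steward): organ O42.2b «WEIGHT-ONE CENTRE WITNESS» of the
REPORT-FIRST memo `K2/K2Liu-p02/g2/REPORT-FIRST-42-…md` §3, making ★ (C1) `K2LiuEisensteinResidueCentreObstruction.typedResidue_eq_zero`
hypothesis-free at the socket's frame `(N, M) = (2, 1)`.  2026-09-04.
-/
import Summits.HodgeConjecture.HodgeConjecture.Theorems.K2LiuEisensteinResidueCentreObstruction   -- ★ p856052 (C1)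
import Literature.NumberTheory.Automorphic.Liu2021.Def411WeilCarriersCentralTypeRigidity         -- ★ `archUnit`, `coe_archUnit`
import Literature.NumberTheory.Automorphic.RelNormOneTorusArchCircles                            -- ★ `relNormOneInfUnitsEquivCircles`
import Literature.NumberTheory.Automorphic.ConjugateSelfDualInfinityType                         -- ★ `coe_unitPart_infLocalUnits_of_mem_normOneTorus`
import Literature.Analysis.Complex.AngularPart                                                   -- ★ `Complex.exists_norm_eq_one_zpow_ne_one`
import HarnessLib

/-!
# K2_Liu road (hLiu418 = stmt-HodgeConjecture-24832), unit U6 «FIRST TERM», organ O42.2b: a weight-one character is not trivial on the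
# squares of the archimedean norm-one torus — and the hypothesis-free CENTRE OBSTRUCTION for socket #42 as typed in U6 ED. 3∕4

Cell `pub/hodgecm-mathlib` (D-0151), Track B; socket #42R `sig_K2LiuEisensteinResidueIsThetaIntegral`, STEWARD K2Liu-p02 (g2).  ★ (C1)
`K2LiuEisensteinResidueCentreObstruction.typedResidue_eq_zero` (p856052) shows that the weight-free conclusion of #42 (U6 ED. 3 :265 ∕ ED. 4 :277)
forces the residue `R = Σ κ_i I_i` to vanish identically AS SOON AS some `u ∈ U(1)(𝔸_{L⁺})` has `χ_λ(u^{N·M}) ≠ 1`.  This file supplies that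
`u` from the socket's own hypothesis `HasWeight L lam 1` ([Liu2021, Def. 4.3]): at any complex place `w₀` the component of a weight-one `λ` is
`z ↦ arg(z)^{±1}` ([Liu2021, Remark 4.2]; ★ `IdeleClassGroup.HasInfinityType`), so on the archimedean norm-one unit `u = (ζ at w₀, 1 elsewhere)`
(★ `archUnit` of the circle tuple `mulSingle w₀ ζ`, ★ `relNormOneInfUnitsEquivCircles`) one has `χ_λ(u) = ζ^{±1}` and `χ_λ(u^k) = ζ^{±k} ≠ 1` for a
suitable `ζ ∈ S¹` (★ `Complex.exists_norm_eq_one_zpow_ne_one`).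

* `toHeckeCharacter_archUnit_eq_archWeight` — `χ_λ((t, 1)) = ∏_w ι_w(t_w)^{e_w}` for `λ` of ∞-type `e` and `t ∈ U(1)(L⁺ ⊗ ℝ)` (★ `archWeight`).
* **`exists_adelicOne_toHeckeCharacter_pow_ne_one`** — for `λ` of weight one and every `k ≠ 0`: `∃ u ∈ U(1)(𝔸_{L⁺}), χ_λ(u^k) ≠ 1`.
* **`typedResidue_eq_zero_of_hasWeight_one`** — (C1) WITHOUT the witness hypothesis at `(N, M) = (2, 1)`: under `HasWeight L lam 1`, the typed
  (weight-free) #42-conclusion for `(f, P, Es)` forces `Σ_i κ_i I_i ≡ 0` — the kernel-checked form of «#42 AS TYPED in ED. 3∕4 says Res ≡ 0»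
  (LEAD «M-154s» (S1); repaired in ED. 5∕6 by the weight token (S2)).

Mathlib + ★ only; no `sorry`, no definition, no instance.  HONEST LABEL: HC_CM is proved only modulo the 7 printed citations (2 remaining named
inputs: hLiu418 = stmt-HodgeConjecture-24832, h413 = stmt-HodgeConjecture-24833) until rung 0 closes; this file is a `--supports
stmt-HodgeConjecture-24832 --as helper` NEGATIVE-SIDE helper (it shows a superseded typed socket vacuous; it refutes nothing in force).

References: [Liu2021] Y. Liu, Camb. J. Math. 9 (2021), §4.1 Def. 4.1, Remark 4.2, Def. 4.3; App. B p. 104; [WeilBNT1967] A. Weil, Basic Number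
Theory, Ch. VII §3 (∞-types); [GanQiuTakeda2014] §7 Thm. 20 (i); [Tan1999] §1.
-/

set_option autoImplicit false
set_option linter.dupNamespace false
-- statements over the adelic dual-pair carriers elaborate to very large types; elaborate sequentially (as in ★ `K2LiuSeesawFubini`)
set_option Elab.async false

noncomputable section

open NumberField NumberField.InfinitePlace MeasureTheory IsDedekindDomain Filter
open scoped Matrix Topology ComplexOrder

namespace Summit.HodgeConjecture.HodgeConjecture.Cruxes.HLiu418.K2LiuWeightOneCentreWitness

open Literature.NumberTheory.Automorphic Literature.NumberTheory.Automorphic.UnitaryGroup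
open Literature.NumberTheory.Automorphic.InfiniteAdeleRing
open Literature.NumberTheory.Automorphic.IdeleClassGroup
open Literature.NumberTheory.Automorphic.Liu2021
open Literature.NumberTheory.Automorphic.Liu2021.Def411WeilCarriers
open Literature.NumberTheory.Automorphic.Liu2021.Def411WeilCarriersDoubling
open Literature.NumberTheory.GaloisRepresentations
open Literature.NumberTheory.GelbartRogawski1991 Literature.NumberTheory.GelbartRogawski1991.UnitaryDualPair
open Literature.NumberTheory.GelbartRogawski1991.GRConstruction
open Literature.NumberTheory.Weil1964
open Literature.RepresentationTheory.Liu2021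
open Literature.NumberTheory.K2Lit.SiegelDoubled
open Literature.NumberTheory.K2Lit.DoubledLineTheta
open Summit.HodgeConjecture.HodgeConjecture.Cruxes.HLiu418.K2LiuEisensteinResidueCentreObstruction (typedResidue_eq_zero)

variable (L : Type) [Field L] [NumberField L] [IsCMField L]

/-! ## §1 A Hecke character of ∞-type `e` on the archimedean norm-one torus -/

/-- **`χ_λ((t, 1)) = ∏_w ι_w(t_w)^{e_w}`** for `λ` of ∞-type `e` and `t ∈ U(1)(L⁺ ⊗ ℝ)`: on the norm-one torus the factors
`arg(ι_w t_w)` of the ∞-type character ARE the components (★ `coe_unitPart_infLocalUnits_of_mem_normOneTorus`), i.e. the value is the typed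
archimedean weight ★ `archWeight L e t`. [cite: Liu2021, Remark 4.2] [cite: WeilBNT1967, Ch. VII §3] -/
theorem toHeckeCharacter_archUnit_eq_archWeight {lam : Literature.NumberTheory.Automorphic.IdeleClassGroup L →ₜ* Circle}
    {e : InfinitePlace L → ℤ} (he : HasInfinityType L lam e) (t : relNormOneInfUnits (↥(maximalRealSubfield L)) L) :
    ((toHeckeCharacter L lam ((archUnit L t : CMAdelicOne L) : ideleGroup L) : ℂˣ) : ℂ) = archWeight L e t := by
  have ht : (t : (InfiniteAdeleRing L)ˣ) ∈ normOneTorus L := by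
    rw [← relNormOneInfUnits_eq_normOneTorus L]; exact t.2
  rw [coe_archUnit, coe_toHeckeCharacter_apply, ← infUnitsToClass_apply, he, infinityTypeChar_apply, archWeight_eq_prod,
    ← Circle.coeHom_apply, map_prod]
  refine Finset.prod_congr rfl fun w _ => ?_
  rw [Circle.coeHom_apply, Circle.coe_zpow, coe_unitPart_infLocalUnits_of_mem_normOneTorus L ht w, coe_archPlaceChar]

/-! ## §2 The witness: `χ_λ(u^k) ≠ 1` for a weight-one `λ` -/

/-- **For `λ` of WEIGHT ONE and `k ≠ 0` there is `u ∈ U(1)(𝔸_{L⁺})` with `χ_λ(u^k) ≠ 1`**: take a complex place `w₀` (every place of the CM field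
`L`), `ζ ∈ S¹` with `ζ^{k·e_{w₀}} ≠ 1` (`e_{w₀} = ±1`), and `u = (ζ at w₀, 1 elsewhere)` read in `U(1)(𝔸_{L⁺})` through ★ `relNormOneInfUnitsEquivCircles`
and ★ `archUnit`. [cite: Liu2021, Remark 4.2, Def. 4.3] -/
theorem exists_adelicOne_toHeckeCharacter_pow_ne_one {lam : Literature.NumberTheory.Automorphic.IdeleClassGroup L →ₜ* Circle}
    (hwt : HasWeight L lam 1) {k : ℕ} (hk : k ≠ 0) :
    ∃ u : adelicOne (Fp L) L (IsCMField.complexConj L),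
      ((toHeckeCharacter L lam ((u : ideleGroup L) ^ k) : ℂˣ) : ℂ) ≠ 1 := by
  classical
  obtain ⟨e, he, hwe⟩ := hwt
  obtain ⟨w₀⟩ := (inferInstance : Nonempty (InfinitePlace L))
  have hew : (e w₀).natAbs = 1 := by
    have := congrFun hwe w₀
    rwa [weight_apply] at this
  have hd : (k : ℤ) * e w₀ ≠ 0 := mul_ne_zero (by exact_mod_cast hk) (fun h0 => by rw [h0] at hew; simp at hew)
  obtain ⟨ζ, hζ1, hζd⟩ := Literature.Analysis.Complex.exists_norm_eq_one_zpow_ne_one hd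
  -- the circle tuple `(ζ at w₀, 1 elsewhere)` and its norm-one archimedean unit
  set ζc : Circle := ⟨ζ, mem_sphere_zero_iff_norm.mpr hζ1⟩ with hζc
  set t : relNormOneInfUnits (↥(maximalRealSubfield L)) L := (relNormOneInfUnitsEquivCircles L).symm (Pi.mulSingle w₀ ζc) with htdef
  refine ⟨archUnit L t, fun h1 => hζd ?_⟩
  -- `χ_λ(u) = ζ^{e w₀}`
  have hval : ((toHeckeCharacter L lam ((archUnit L t : CMAdelicOne L) : ideleGroup L) : ℂˣ) : ℂ) = ζ ^ e w₀ := by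
    rw [toHeckeCharacter_archUnit_eq_archWeight L he, archWeight_eq_prod,
      Finset.prod_eq_single w₀ (fun w _ hw => ?_) (fun h => (h (Finset.mem_univ _)).elim)]
    · rw [← archPlaceChars_apply, htdef, archPlaceChars_relNormOneInfUnitsEquivCircles_symm, Pi.mulSingle_eq_same]
    · rw [← archPlaceChars_apply, htdef, archPlaceChars_relNormOneInfUnitsEquivCircles_symm, Pi.mulSingle_eq_of_ne hw, Circle.coe_one,
        one_zpow]
  -- `χ_λ(u^k) = ζ^{k e w₀} = 1`
  have h2 : ((toHeckeCharacter L lam (((archUnit L t : CMAdelicOne L) : ideleGroup L) ^ k) : ℂˣ) : ℂ) = (ζ ^ e w₀) ^ k := by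
    rw [map_pow, Units.val_pow_eq_pow_val, hval]
  rw [h2] at h1
  rw [mul_comm, zpow_mul, zpow_natCast]
  exact h1

/-! ## §3 (C1) hypothesis-free at the socket's frame `(N, M) = (2, 1)` -/

variable {n : ℕ} (e : Fin 2 × Fin 1 ≃ Fin n)
  (dV : Fin 2 → L) (hdV : ∀ i, IsCMField.complexConj L (dV i) = dV i) (hdV0 : ∀ i, dV i ≠ 0)
  (dW : Fin 1 → L) (hdW : ∀ i, IsCMField.complexConj L (dW i) = dW i) (hdW0 : ∀ i, dW i ≠ 0)
  {n'' : ℕ} (e₁ : Fin (n + n) × Fin 1 ≃ Fin n'')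
  (lam : Literature.NumberTheory.Automorphic.IdeleClassGroup L →ₜ* Circle) (hlam : IsConjugateSymplectic L lam)

set_option maxHeartbeats 1000000 in -- the D8 telescope (cf. ★ `K2LiuSeesawFubini`)
include hdV0 hdW0 in
/-- **THE CENTRE OBSTRUCTION, HYPOTHESIS-FREE (frame `(N, M) = (2, 1)`, `HasWeight L lam 1`).**  For a conjugate-symplectic weight-one `λ`, a family
of Siegel sections `f_s ∈ I(s, χ_λ)` on `H(𝔸) = U(2,2)(𝔸)`, a continuation `(P, Es)` with #41's clauses (i)(iv), a point `s₀` with `0 < Re s₀`, and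
weight-free doubled line theta data `(k, a′, κ, Φ′, hρ, μW)` with invariant `μW_i`: if `(s − s₀)·Es(s, h)/∏(s − p) → Σ_i κ_i I_i(h)` for every `h`
(the conclusion of #42 AS TYPED in U6 ED. 3∕4), then `Σ_i κ_i I_i(h) = 0` for every `h`.  (★ `typedResidue_eq_zero` with the witness of §2 at
`N·M = 2`.)  Hence the weight-free socket asserted «Res ≡ 0» for every standard family — false where s5 needs it; the repair is ED. 5's weight.
[cite: Liu2021, App. B p. 104; Def. 4.3] [cite: GanQiuTakeda2014, §7 Thm. 20 (i)] [cite: Tan1999, §1] -/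
theorem typedResidue_eq_zero_of_hasWeight_one (hwt : HasWeight L lam 1) (f : ℂ → HA L e dV hdV dW hdW → ℂ)
    (hf : IsSiegelDeltaSectionFamily L e dV hdV dW hdW (toHeckeCharacter L lam) f) (P : Finset ℂ) (Es : ℂ → HA L e dV hdV dW hdW → ℂ)
    (hhol : ∀ h : HA L e dV hdV dW hdW, DifferentiableOn ℂ (fun s => Es s h) {s : ℂ | 0 < s.re})
    (heq : ∀ (s : ℂ) (h : HA L e dV hdV dW hdW), (n : ℝ) / 2 < s.re →
      Es s h = (∏ p ∈ P, (s - p)) * eisensteinFamilyDelta L e dV hdV dW hdW f s h)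
    {s₀ : ℂ} (hs₀ : 0 < s₀.re)
    {k : ℕ} (a' : Fin k → (↥(maximalRealSubfield L))ˣ) (κ : Fin k → ℂ)
    (Φ' : Fin k → piSchwartzBruhat (↥(maximalRealSubfield L)) (Fin n''))
    (hρ : ∀ i, HasThetaMajorants fun
      (p : ↥(UnitaryGroup.adelic (↥(maximalRealSubfield L)) L (IsCMField.complexConj L) (n + n) (Matrix.diagonal (dD L e dV hdV dW hdW))) ×
        ↥(UnitaryGroup.adelic (↥(maximalRealSubfield L)) L (IsCMField.complexConj L) 1 (JW (↥(maximalRealSubfield L)) L (a' i))))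
      (Φ : piSchwartzBruhat (↥(maximalRealSubfield L)) (Fin n'')) =>
        pairRep (↥(maximalRealSubfield L)) L (IsCMField.complexConj L) (n + n) 1 e₁ (Matrix.diagonal (dD L e dV hdV dW hdW)) (JW (↥(maximalRealSubfield L)) L (a' i))
          (chiSplittingLine L e₁ (dD L e dV hdV dW hdW) (dD_conj L e dV hdV dW hdW) (dD_ne_zero L e dV hdV dW hdW hdV0 hdW0)
            (toHeckeCharacter L lam) (isUnitary_toHeckeCharacter L lam)
            ((isOscillatorChar_toHeckeCharacter_iff lam).mpr hlam) (TW (↥(maximalRealSubfield L)) (a' i))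
            (isUnit_det_TW (↥(maximalRealSubfield L)) (a' i)) (JW (↥(maximalRealSubfield L)) L (a' i)) (JW_eq (↥(maximalRealSubfield L)) L (a' i)))
          p Φ)
    (μW : ∀ i, @Measure (↥(UnitaryGroup.adelic (↥(maximalRealSubfield L)) L (IsCMField.complexConj L) 1 (JW (↥(maximalRealSubfield L)) L (a' i))) ⧸
      (UnitaryGroup.toAdelic (↥(maximalRealSubfield L)) L (IsCMField.complexConj L) 1 (JW (↥(maximalRealSubfield L)) L (a' i))).range) (borel _))
    (hinv : ∀ i, @SMulInvariantMeasure
      ↥(UnitaryGroup.adelic (↥(maximalRealSubfield L)) L (IsCMField.complexConj L) 1 (JW (↥(maximalRealSubfield L)) L (a' i)))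
      (↥(UnitaryGroup.adelic (↥(maximalRealSubfield L)) L (IsCMField.complexConj L) 1 (JW (↥(maximalRealSubfield L)) L (a' i))) ⧸
        (UnitaryGroup.toAdelic (↥(maximalRealSubfield L)) L (IsCMField.complexConj L) 1 (JW (↥(maximalRealSubfield L)) L (a' i))).range)
      _ (borel _) (μW i))
    (hlim : ∀ h : HA L e dV hdV dW hdW,
      Tendsto (fun s : ℂ => (s - s₀) * (Es s h / ∏ p ∈ P, (s - p))) (𝓝[≠] s₀)
        (𝓝 (∑ i, κ i * @doubledLineThetaIntegral L _ _ _ 2 1 n e dV hdV dW hdW n'' e₁ hdV0 hdW0 lam hlam (a' i) (hρ i)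
          (borel _) (μW i) (Φ' i) h)))
    (h : HA L e dV hdV dW hdW) :
    (∑ i, κ i * @doubledLineThetaIntegral L _ _ _ 2 1 n e dV hdV dW hdW n'' e₁ hdV0 hdW0 lam hlam (a' i) (hρ i)
        (borel _) (μW i) (Φ' i) h) = 0 := by
  obtain ⟨u, hu⟩ := exists_adelicOne_toHeckeCharacter_pow_ne_one L hwt (k := 2 * 1) (by norm_num)
  exact typedResidue_eq_zero L e dV hdV hdV0 dW hdW hdW0 e₁ lam hlam f hf P Es hhol heq hs₀ a' κ Φ' hρ μW hinv hlim u hu h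

end Summit.HodgeConjecture.HodgeConjecture.Cruxes.HLiu418.K2LiuWeightOneCentreWitness

end
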